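import Summits.QuantumFields.YangMills.Theorems.UniversalDetectorGaussDeconv
import Summits.QuantumFields.YangMills.Theorems.UniversalDetectorSymmetrySpread
import Summits.QuantumFields.YangMills.Theses.UniversalDetector

/-!
# Route `UniversalDetector`, crux `DetectorRigidity` (stmt-QuantumFields-26595) reduced to its stub 1

Ideator seat ym-idea-8 g4.  The registered birth skeleton of the lever crux (`Cruxes/DetectorRigidity/Lines/birth.lean`,
`DetectorRigidity_of : Stmt_semigroupKill → Stmt_gaussDeconv → Stmt_symmetrySpread → DetectorRigidity`) has two of
its three stubs landed as theorems: `gaussDeconv` (stub 2, `UniversalDetectorGaussDeconv.lean`) and `symmetrySpread`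
(stub 3, `UniversalDetectorSymmetrySpread.lean`).  This file records the kernel-checked consequence IN THE TREE: the crux
`DetectorRigidity` follows from stub 1 alone (`Stmt_semigroupKill` — the injective-OS-semigroup step, XL — restated
VERBATIM as the hypothesis, since `Cruxes/…/Lines` modules are not importable).  The crux item stays open; no summit,
leg or spine crux is proved here.
-/

set_option autoImplicit false

namespace Summit.QuantumFields.YangMills.Cruxes.DetectorRigidity

open MeasureTheory Literature.MathematicalPhysics.QuantumLattice
open Summit.QuantumFields.YangMills.Theses.UniversalDetector

/-- **`DetectorRigidity` from stub 1 alone.**  The hypothesis is `Stmt_semigroupKill` of the birth skeleton, verbatim: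
under all hypotheses of the crux, the vanishing mirror pairing of ONE non-negative Gaussian-profile vector forces the
mirror pairing of every (Gaussian-profile, positive-slab) pair to vanish.  Stubs 2 (`gaussDeconv`) and 3
(`symmetrySpread`) then give `K = 0` off the origin. -/
theorem detectorRigidity_of_semigroupKill
    (h1 :
      ∀ (K : EuclideanSpace ℝ (Fin 4) → ℝ) (h : ℝ → ℝ) (ta tb : ℝ) (v₀ : SchwartzMap (EuclideanSpace ℝ (Fin 4)) ℝ),
        ContinuousOn K {z | z ≠ 0} →
        (∀ η : ℝ, 0 < η → ∃ C : ℝ, ∀ z : EuclideanSpace ℝ (Fin 4), η ≤ ‖z‖ → |K z| ≤ C) →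
        (∀ z : EuclideanSpace ℝ (Fin 4), K (-z) = K z) →
        (∀ z : EuclideanSpace ℝ (Fin 4), K (timeReflection 4 z) = K z) →
        (∀ (σ : Equiv.Perm (Fin 4)) (z : EuclideanSpace ℝ (Fin 4)), K (WithLp.toLp 2 fun i => z (σ i)) = K z) →
        (∀ (w : SchwartzMap (EuclideanSpace ℝ (Fin 4)) ℝ) (t₀ T : ℝ), 0 < t₀ →
          tsupport (w : EuclideanSpace ℝ (Fin 4) → ℝ) ⊆ {y | t₀ ≤ y 0 ∧ y 0 ≤ T} →
          0 ≤ ∫ x, ∫ y, (thetaTest 4 w) x * w y * K (y - x)) →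
        0 < ta → Continuous h → (∀ t, 0 ≤ h t) → tsupport h ⊆ Set.Icc ta tb → (∃ t, h t ≠ 0) →
        (∀ y, v₀ y = h (y 0) * Real.exp (-‖y‖ ^ 2)) →
        (∫ x, ∫ y, (thetaTest 4 v₀) x * v₀ y * K (y - x)) = 0 →
        ∀ (w₁ w₂ : SchwartzMap (EuclideanSpace ℝ (Fin 4)) ℝ) (h₁ : ℝ → ℝ) (t₁ T₁ t₂ T₂ : ℝ),
          0 < t₁ → Continuous h₁ → tsupport h₁ ⊆ Set.Icc t₁ T₁ →
          (∀ y, w₁ y = h₁ (y 0) * Real.exp (-‖y‖ ^ 2)) → 0 < t₂ →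
          tsupport (w₂ : EuclideanSpace ℝ (Fin 4) → ℝ) ⊆ {y | t₂ ≤ y 0 ∧ y 0 ≤ T₂} →
          (∫ x, ∫ y, (thetaTest 4 w₁) x * w₂ y * K (y - x)) = 0) :
    DetectorRigidity := by
  intro K h ta tb v₀ hc hb he hθ hσ hrp hta hh h0 hsupp hne hv hpair z hz
  exact symmetrySpread K hθ hσ
    (gaussDeconv K hc hb (h1 K h ta tb v₀ hc hb he hθ hσ hrp hta hh h0 hsupp hne hv hpair)) z hz

end Summit.QuantumFields.YangMills.Cruxes.DetectorRigidity
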